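import Literature.Barriers.CriticalPhenomena.PlaquetteWalkWoundExcursionTurning
import Literature.Barriers.CriticalPhenomena.PlaquetteWalkHoleRootFirstTurn
import Literature.Barriers.CriticalPhenomena.PlaquetteWalkAngleLimitRowCoherence
import HarnessLib

/-!
# Barrier catalogue (SAWScalingLimit): CHIRALITY of the principal level-`5` members — a cost-`5` wound class-`B2a` walk met along the
initial run, without doubly visited plaquettes, turns five times the SAME way («CHIRALITY»)

`Z → ∞` limit model of the printed Yang–Baxter weights [GlazmanManolescu2019, §1, eq. (1)]; the «RECTANGLE COEFFICIENT» line. Inputs: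
`PlaquetteWalkWoundExcursionTurning` (a wound excursion turns `woundTurns z₀ z₁ z₂ ∈ {±4, ±5}` quarter turns; tightness ⇒ one chirality),
`PlaquetteWalkHoleRootFirstTurn` (no doubly visited plaquette at cost `5` ⇒ slanted end), `PlaquetteWalkHoleRootInitialRun` (the straight
prefix runs east along the hole row), `PlaquetteWalkAngleLimitRowCoherence.isolated_eq_of_cost_five` (`n_{u₁} + n_{u₂} = 4 + slotDeg`).

* `YBWalk.turns_eq_isolated_add_two_pairs`: the turning arcs of a walk number `n_{u₁} + n_{u₂} + 2(n_{w₁} + n_{w₂})` (private plumbing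
  `List.countP_or_of_disjoint`);
  `YBWalk.pairs_eq_zero_of_injective`: no doubly visited plaquette ⇒ `n_{w₁} = n_{w₂} = 0`.
* ★★★ `ΩG.chirality_of_cost_five`: for a wound class-`B2a` walk `ω` of limit cost `5` from the hole root `w.side W` whose prefix before the
  first arc in `r` is straight (so `r = (w.1 + firstHitG, w.2)` lies on the ROOT ROW, entered from `W`) and whose plaquette map is injective:
  EITHER `ω` ends on the `S` side of `r` and every turning arc is a LEFT quarter turn (`q = +5`), OR it ends on the `N` side and every
  turning arc is a RIGHT quarter turn (`q = −5`). (Five turning arcs in all; the excursion carries `5 − [first arc turns]` of them, at least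
  `|woundTurns(W, z₁, z₂)|`, which is `5` for a straight first arc and `4` otherwise — no slack, one chirality, and the table's sign.)
* ★★ `ΩG.quarterTurnsL_of_wound_straight_prefix`: `q(ω) = qTurn(z₀,z₁) + woundTurns z₀ z₁ z₂` for every wound walk with straight prefix;
  ★★ `ΩG.quarterTurns_of_cost_five`: at cost `5` this is `+5` (`S`) or `−5` (`N`).
* ★★★ `ΩG.chirality_of_cost_seven_east` / ★★ `ΩG.quarterTurns_of_cost_seven_east`: the same at limit cost `7` with end side `E` — the
  PARENTS of the level-`5` class-`B2b` members (`PlaquetteWalkHoleRootExtensionCost.cost_ext₃_eq_five_iff`): six turning arcs, all LEFT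
  (exit `N`, `q = +6`) or all RIGHT (exit `S`, `q = −6`); note `q = ±6` needs only the wound winding law, not the cost.

Use (venture lane «pcv-sawmu», b-engine-1 g25; DESIGN-next-g24 §2bis (R3)/(R4)): the orientation step of the root-row classification — the
classes `as`/`ao`/`ac` of the exact census (kit j276221) are all-left (→ `S`) or all-right (→ `N`); `PlaquetteWalkHoleRootRowClasses` turns
this into `n_{VL} ∈ {2, 0}` and ROW COHERENCE. Conditional on the absence of doubly visited plaquettes (census: `n_w = 0` for every
cost-`5` class-`B2a` member) and on the straight prefix. [GlazmanManolescu2019 §1 Fig. 1, Lemma 2.1; Glazman 2015 Lemma 3.1 (proof, pp. 6–7)]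
-/

noncomputable section

namespace Literature.Probability.RandomPlanarGeometry.SAW.YangBaxter

open Real
open Literature.Barriers.CriticalPhenomena.PlaquetteWalk

open private fc_fh from Literature.Probability.RandomPlanarGeometry.YangBaxterSAWGeneralDomain

/-! ## Turning arcs versus configuration counts -/

/-- Counting a disjoint disjunction. [folklore] (lane plumbing) -/
private theorem List.countP_or_of_disjoint {α : Type*} (l : List α) (A B : α → Prop) [DecidablePred A] [DecidablePred B]
    (h : ∀ x ∈ l, ¬(A x ∧ B x)) :
    l.countP (fun x => decide (A x ∨ B x)) = l.countP (fun x => decide (A x)) + l.countP (fun x => decide (B x)) := by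
  induction l with
  | nil => simp
  | cons x l ih =>
    rw [List.countP_cons, List.countP_cons, List.countP_cons, ih (fun y hy => h y (by simp [hy]))]
    have hx := h x (by simp)
    by_cases hA : A x <;> by_cases hB : B x
    · exact absurd ⟨hA, hB⟩ hx
    · simp [hA, hB]; omega
    · simp [hA, hB]; omega
    · simp [hA, hB]

namespace YBWalk

variable {D : Set Face} {a z : MidEdge} (γ : YBWalk D a z)

/-- For an arc of a walk, a non-zero quarter turn means a `θ`-corner or a `(π−θ)`-corner arc. [cite: GlazmanManolescu2019, §1, Fig. 1; §2.1] -/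
theorem qTurnOf_ne_zero_iff_kind {p : MidEdge × MidEdge} (hp : p ∈ γ.arcs) :
    qTurnOf p ≠ 0 ↔ (arcKindOf p = some .corner ∨ arcKindOf p = some .coCorner) := by
  obtain ⟨m, hm, rfl⟩ := List.getElem_of_mem hp
  rw [γ.qTurnOf_getElem_ne_zero_iff hm, (γ.arcKindOf_getElem hm).2]
  have hsd := γ.sIn_ne_sOut hm
  revert hsd
  cases γ.sIn m <;> cases γ.sOut m <;> simp [arcKind]

/-- ★ **THE TURNING ARCS OF A WALK NUMBER `n_{u₁} + n_{u₂} + 2(n_{w₁} + n_{w₂})`** (one per isolated-turn plaquette, two per doubly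
visited plaquette). [cite: GlazmanManolescu2019, §1, Fig. 1 and eq. (1)] -/
theorem turns_eq_isolated_add_two_pairs :
    γ.arcs.countP (fun p => qTurnOf p ≠ 0) =
      cfgCount γ.mids [.corner] + cfgCount γ.mids [.coCorner] +
        2 * (cfgCount γ.mids [.corner, .corner] + cfgCount γ.mids [.coCorner, .coCorner]) := by
  have h1 := countP_corner_eq_cfgCount γ
  have h2 := countP_coCorner_eq_cfgCount γ
  have e : γ.arcs.countP (fun p => qTurnOf p ≠ 0) =
      γ.arcs.countP (fun p => decide (arcKindOf p = some .corner ∨ arcKindOf p = some .coCorner)) :=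
    List.countP_congr fun p hp => by simpa using γ.qTurnOf_ne_zero_iff_kind hp
  rw [e, List.countP_or_of_disjoint _ _ _ (fun p _ hh => by rw [hh.1] at hh; exact absurd hh.2 (by simp))]
  change (arcsOf γ.mids).countP _ + (arcsOf γ.mids).countP _ = _
  rw [h1, h2]; ring

/-- ★ **NO DOUBLY VISITED PLAQUETTE ⇒ `n_{w₁} = n_{w₂} = 0`**: if the plaquette map `fc` is injective, no plaquette carries two arcs.
[cite: GlazmanManolescu2019, §1, Fig. 1 (the configurations `w₁`, `w₂`)] -/
theorem pairs_eq_zero_of_injective (hinj : ∀ i j, i < γ.arcs.length → j < γ.arcs.length → γ.fc i = γ.fc j → i = j) :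
    cfgCount γ.mids [.corner, .corner] = 0 ∧ cfgCount γ.mids [.coCorner, .coCorner] = 0 := by
  have key : ∀ κ : ArcKind, cfgCount γ.mids [κ, κ] = 0 := by
    intro κ
    unfold cfgCount
    rw [List.countP_eq_zero]
    intro f hf
    obtain ⟨m, hm, rfl⟩ := γ.exists_fc_eq_of_mem_facesL hf
    rw [γ.kindsL_eq_singleton_of_single_visit hm (fun j hj he => hinj j m hj hm he)]
    simp
  exact ⟨key _, key _⟩

/-- The quarter turns of the arcs before index `k` vanish when those arcs are straight. [cite: GlazmanManolescu2019, §1, Fig. 1; §2.1] -/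
theorem qTurnOf_eq_zero_of_mem_take {k : ℕ} (hk : k ≤ γ.arcs.length) (hstr : ∀ i < k, arcKind (γ.sIn i) (γ.sOut i) = .straight)
    {p : MidEdge × MidEdge} (hp : p ∈ γ.arcs.take k) : qTurnOf p = 0 := by
  obtain ⟨i, hi, rfl⟩ := List.getElem_of_mem hp
  rw [List.length_take] at hi
  have hik : i < k := by omega
  rw [List.getElem_take]
  by_contra hne
  exact ((γ.qTurnOf_getElem_ne_zero_iff (by omega)).1 hne) (hstr i hik)

end YBWalk

/-! ## Chirality at limit cost `5` -/

namespace ΩG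

variable {D : Set Face} {w r : Face} {ω : ΩG D (w.side .W) r}

/-- The three pieces of the arc list around the first arc in `r`: prefix, first arc, excursion.
[cite: Glazman2015WeightedSAW, Lemma 3.1 (proof, pp. 6–7: the first crossing of `∂r` and the excursion)] -/
theorem arcs_eq_take_append (h : ω.IsB2a) :
    ω.2.arcs = ω.2.arcs.take ω.2.firstHitG ++ ω.2.arcs[ω.2.firstHitG]'(ω.fh_lt h) :: ω.2.arcs.drop (ω.2.firstHitG + 1) := by
  rw [← List.drop_eq_getElem_cons, List.take_append_drop]

/-- With a straight prefix, the number of turning arcs of the excursion is the total number minus `[the first arc in r turns]`.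
[cite: GlazmanManolescu2019, §1, Fig. 1; Lemma 2.1 (the first arc in `r`)] -/
theorem excursion_turns_of_straight_prefix (hr : RootedFace D (w.side .W) r) (h : ω.IsB2a)
    (hstr : ∀ i < ω.2.firstHitG, arcKind (ω.2.sIn i) (ω.2.sOut i) = .straight) :
    (ω.2.arcs.drop (ω.2.firstHitG + 1)).countP (fun p => qTurnOf p ≠ 0) +
        (if qTurn ω.2.firstSideG (ω.z1 hr h) ≠ 0 then 1 else 0) =
      ω.2.arcs.countP (fun p => qTurnOf p ≠ 0) := by
  have hfh := ω.fh_lt h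
  obtain ⟨hf1, hf2, hf3⟩ := fc_fh ω hr h
  have hq : qTurnOf (ω.2.arcs[ω.2.firstHitG]'hfh) = qTurn ω.2.firstSideG (ω.z1 hr h) := by
    rw [ω.2.qTurnOf_getElem hfh, hf2, hf3]; rfl
  conv_rhs => rw [arcs_eq_take_append h]
  rw [List.countP_append, List.countP_cons, hq]
  have h0 : (ω.2.arcs.take ω.2.firstHitG).countP (fun p => qTurnOf p ≠ 0) = 0 := by
    rw [List.countP_eq_zero]
    intro p hp
    simpa using ω.2.qTurnOf_eq_zero_of_mem_take hfh.le hstr hp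
  rw [h0]
  by_cases hz : qTurn ω.2.firstSideG (ω.z1 hr h) ≠ 0
  · simp [hz]
  · simp [hz]

/-- With a straight prefix, the signed quarter turns of the walk are those of the first arc in `r` plus those of the excursion.
[cite: GlazmanManolescu2019, §2.1 (the winding); Lemma 2.1] -/
theorem quarterTurnsL_of_straight_prefix (hr : RootedFace D (w.side .W) r) (h : ω.IsB2a)
    (hstr : ∀ i < ω.2.firstHitG, arcKind (ω.2.sIn i) (ω.2.sOut i) = .straight) :
    quarterTurnsL ω.2.mids = qTurn ω.2.firstSideG (ω.z1 hr h) + ((ω.2.arcs.drop (ω.2.firstHitG + 1)).map qTurnOf).sum := by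
  have hfh := ω.fh_lt h
  obtain ⟨hf1, hf2, hf3⟩ := fc_fh ω hr h
  have hq : qTurnOf (ω.2.arcs[ω.2.firstHitG]'hfh) = qTurn ω.2.firstSideG (ω.z1 hr h) := by
    rw [ω.2.qTurnOf_getElem hfh, hf2, hf3]; rfl
  unfold quarterTurnsL
  change (ω.2.arcs.map qTurnOf).sum = _
  conv_lhs => rw [arcs_eq_take_append h]
  rw [List.map_append, List.map_cons, List.sum_append, List.sum_cons, hq]
  have h0 : ((ω.2.arcs.take ω.2.firstHitG).map qTurnOf).sum = 0 := by
    rw [List.sum_eq_zero]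
    intro x hx
    obtain ⟨p, hp, rfl⟩ := List.mem_map.1 hx
    exact ω.2.qTurnOf_eq_zero_of_mem_take hfh.le hstr hp
  rw [h0, zero_add]

/-- ★★ **THE QUARTER TURNS OF A WOUND WALK WITH STRAIGHT PREFIX ARE RIGID**: `q(ω) = qTurn(z₀, z₁) + woundTurns z₀ z₁ z₂` — the whole
signed quarter-turn count of a wound class-`B2a` walk whose prefix is straight is read off its three sides at `r` (no cost hypothesis).
[cite: GlazmanManolescu2019, §2.1 (the winding); Lemma 2.1 (statement, «in the form given in [Gl]»)] [cite: Glazman2015WeightedSAW, Lemma 3.1 (proof, pp. 6–7)] -/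
theorem quarterTurnsL_of_wound_straight_prefix (hr : RootedFace D (w.side .W) r) (h : ω.IsB2a)
    (hA : ω.AJ hr h (toC (midPt (w.side .W))) ≠ 0) (hstr : ∀ i < ω.2.firstHitG, arcKind (ω.2.sIn i) (ω.2.sOut i) = .straight) :
    quarterTurnsL ω.2.mids = qTurn ω.2.firstSideG (ω.z1 hr h) + woundTurns ω.2.firstSideG (ω.z1 hr h) ω.1 := by
  rw [quarterTurnsL_of_straight_prefix hr h hstr, excursion_quarterTurns_of_wound hr h hA]

/-- A straight prefix from the hole root meets `r` on the ROOT ROW from the `W` side: `r = (w.1 + firstHitG, w.2)`, `z₀ = W`.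
[cite: Glazman2015WeightedSAW, Lemma 3.1 (proof, pp. 6–7: the first crossing of `∂r`)] [cite: GlazmanManolescu2019, §1, Fig. 1] -/
theorem root_row_of_straight_prefix (hh : holeFaceW w ∉ D) (hr : RootedFace D (w.side .W) r) (h : ω.IsB2a)
    (hstr : ∀ i < ω.2.firstHitG, arcKind (ω.2.sIn i) (ω.2.sOut i) = .straight) :
    r = (w.1 + ω.2.firstHitG, w.2) ∧ ω.2.firstSideG = .W := by
  obtain ⟨hrun, -⟩ := ω.2.initial_run hh (ω.fh_lt h) hstr
  obtain ⟨hfc, hW⟩ := hrun ω.2.firstHitG le_rfl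
  obtain ⟨hf1, hf2, -⟩ := fc_fh ω hr h
  exact ⟨hf1.symm.trans hfc, hf2.symm.trans hW⟩

/-- ★★★ **CHIRALITY AT LIMIT COST `5`.** Let `ω` be a WOUND class-`B2a` walk of limit cost `5` from the hole root `w.side W` (hole
`(w.1 − 1, w.2)` absent) whose arcs before the first arc in `r` are straight and whose plaquette map is injective (no doubly visited
plaquette). Then EITHER `ω` returns to the `S` side of `r` and every turning arc of `ω` is a LEFT quarter turn, OR it returns to the `N`
side and every turning arc is a RIGHT quarter turn. [cite: GlazmanManolescu2019, §1, Fig. 1 and eq. (1); Lemma 2.1 (statement, «in the form given in [Gl]»)]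
[cite: Glazman2015WeightedSAW, Lemma 3.1 (proof, pp. 6–7)] -/
theorem chirality_of_cost_five (hh : holeFaceW w ∉ D) (hr : RootedFace D (w.side .W) r) (h : ω.IsB2a)
    (hA : ω.AJ hr h (toC (midPt (w.side .W))) ≠ 0) (hc : cost (slotOfSide ω.1) ω.2.mids = 5)
    (hinj : ∀ i j, i < ω.2.arcs.length → j < ω.2.arcs.length → ω.2.fc i = ω.2.fc j → i = j)
    (hstr : ∀ i < ω.2.firstHitG, arcKind (ω.2.sIn i) (ω.2.sOut i) = .straight) :
    (ω.1 = .S ∧ ∀ p ∈ ω.2.arcs, qTurnOf p ≠ 0 → qTurnOf p = 1) ∨ (ω.1 = .N ∧ ∀ p ∈ ω.2.arcs, qTurnOf p ≠ 0 → qTurnOf p = -1) := by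
  have hfh := ω.fh_lt h
  obtain ⟨-, hW⟩ := root_row_of_straight_prefix hh hr h hstr
  -- slanted end, five turning arcs in all
  have hz := end_slanted_of_injective_cost_five hh hr h hA hc hinj
  have hd : slotDeg (slotOfSide ω.1) = 1 := by rcases hz with e | e <;> rw [e] <;> rfl
  have hiso := isolated_eq_of_cost_five hc
  rw [hd] at hiso
  obtain ⟨hp1, hp2⟩ := ω.2.pairs_eq_zero_of_injective hinj
  have hT : ω.2.arcs.countP (fun p => qTurnOf p ≠ 0) = 5 := by
    rw [ω.2.turns_eq_isolated_add_two_pairs, hp1, hp2, hiso]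
  have hsplit := excursion_turns_of_straight_prefix hr h hstr
  rw [hT, hW] at hsplit
  -- the excursion bound and the table
  obtain ⟨h01, h02, h12⟩ := ω.firstSide_exit_return_distinct hr h
  rw [hW] at h01 h02
  have hle := woundTurns_natAbs_le_excursion_turns hr h hA
  have htight := excursion_chirality_of_tight hr h hA
  have hsum := excursion_quarterTurns_of_wound hr h hA
  rw [hW] at hle htight hsum
  -- prefix arcs and the first arc
  have hpre : ∀ p ∈ ω.2.arcs, qTurnOf p ≠ 0 → p ∉ ω.2.arcs.drop (ω.2.firstHitG + 1) →
      qTurnOf p = qTurn Side.W (ω.z1 hr h) := by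
    intro p hp hq hnd
    rw [arcs_eq_take_append h, List.mem_append, List.mem_cons] at hp
    rcases hp with hp | rfl | hp
    · exact absurd (ω.2.qTurnOf_eq_zero_of_mem_take hfh.le hstr hp) hq
    · obtain ⟨-, hf2, hf3⟩ := fc_fh ω hr h
      rw [ω.2.qTurnOf_getElem hfh, hf2, hf3, hW]; rfl
    · exact absurd hp hnd
  -- case analysis on the exit side `z₁ ∈ {E, N, S}` and the return side `z₂ ∈ {N, S}`
  generalize hz1 : ω.z1 hr h = z₁ at h01 h12 hsplit hle htight hsum hpre
  have finish : ∀ ε : ℤ, (∀ p ∈ ω.2.arcs.drop (ω.2.firstHitG + 1), qTurnOf p ≠ 0 → qTurnOf p = ε) →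
      (qTurn Side.W z₁ = 0 ∨ qTurn Side.W z₁ = ε) → ∀ p ∈ ω.2.arcs, qTurnOf p ≠ 0 → qTurnOf p = ε := by
    intro ε hall hfirst p hp hq
    by_cases hmem : p ∈ ω.2.arcs.drop (ω.2.firstHitG + 1)
    · exact hall p hmem hq
    · have e := hpre p hp hq hmem
      rcases hfirst with h0 | h1
      · exact absurd (e.trans h0) hq
      · exact e.trans h1
  rcases hz with e | e
  · -- return side `N`: all turns are RIGHT turns
    have hwt : woundTurns Side.W z₁ ω.1 = woundTurns Side.W z₁ Side.N := by rw [e]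
    have h12' : z₁ ≠ Side.N := fun h' => h12 (h'.trans e.symm)
    rw [hwt] at hle htight hsum
    refine Or.inr ⟨e, ?_⟩
    cases z₁
    · exact absurd rfl h01
    · -- exit `E` (first arc straight): five turning arcs in the excursion, `woundTurns W E N = −5`
      have hq0 : qTurn Side.W Side.E = 0 := rfl
      have hcnt : (ω.2.arcs.drop (ω.2.firstHitG + 1)).countP (fun p => qTurnOf p ≠ 0) = 5 := by simpa [hq0] using hsplit
      have hv : woundTurns Side.W Side.E Side.N = -5 := rfl
      rw [hv] at htight
      rcases htight (by rw [hcnt]; rfl) with ⟨habs, -⟩ | ⟨-, hall⟩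
      · exact absurd habs (by norm_num)
      · exact finish (-1) hall (Or.inl hq0)
    · -- exit `S` (first arc `W → S`, a right turn): four turning arcs in the excursion, `woundTurns W S N = −4`
      have hq1 : qTurn Side.W Side.S = -1 := rfl
      have hcnt : (ω.2.arcs.drop (ω.2.firstHitG + 1)).countP (fun p => qTurnOf p ≠ 0) = 4 := by
        have : (ω.2.arcs.drop (ω.2.firstHitG + 1)).countP (fun p => qTurnOf p ≠ 0) + 1 = 5 := by simpa [hq1] using hsplit
        omega
      have hv : woundTurns Side.W Side.S Side.N = -4 := rfl
      rw [hv] at htight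
      rcases htight (by rw [hcnt]; rfl) with ⟨habs, -⟩ | ⟨-, hall⟩
      · exact absurd habs (by norm_num)
      · exact finish (-1) hall (Or.inr hq1)
    · exact absurd rfl h12'
  · -- return side `S`: all turns are LEFT turns
    have hwt : woundTurns Side.W z₁ ω.1 = woundTurns Side.W z₁ Side.S := by rw [e]
    have h12' : z₁ ≠ Side.S := fun h' => h12 (h'.trans e.symm)
    rw [hwt] at hle htight hsum
    refine Or.inl ⟨e, ?_⟩
    cases z₁
    · exact absurd rfl h01
    · -- exit `E` (first arc straight): five turning arcs in the excursion, `woundTurns W E S = +5`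
      have hq0 : qTurn Side.W Side.E = 0 := rfl
      have hcnt : (ω.2.arcs.drop (ω.2.firstHitG + 1)).countP (fun p => qTurnOf p ≠ 0) = 5 := by simpa [hq0] using hsplit
      have hv : woundTurns Side.W Side.E Side.S = 5 := rfl
      rw [hv] at htight
      rcases htight (by rw [hcnt]; rfl) with ⟨-, hall⟩ | ⟨habs, -⟩
      · exact finish 1 hall (Or.inl hq0)
      · exact absurd habs (by norm_num)
    · exact absurd rfl h12'
    · -- exit `N` (first arc `W → N`, a left turn): four turning arcs in the excursion, `woundTurns W N S = +4`
      have hq1 : qTurn Side.W Side.N = 1 := rfl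
      have hcnt : (ω.2.arcs.drop (ω.2.firstHitG + 1)).countP (fun p => qTurnOf p ≠ 0) = 4 := by
        have : (ω.2.arcs.drop (ω.2.firstHitG + 1)).countP (fun p => qTurnOf p ≠ 0) + 1 = 5 := by simpa [hq1] using hsplit
        omega
      have hv : woundTurns Side.W Side.N Side.S = 4 := rfl
      rw [hv] at htight
      rcases htight (by rw [hcnt]; rfl) with ⟨-, hall⟩ | ⟨habs, -⟩
      · exact finish 1 hall (Or.inr hq1)
      · exact absurd habs (by norm_num)

/-- ★★ **THE SIGNED QUARTER TURNS OF A PRINCIPAL COST-`5` MEMBER ARE `±5`**: under the hypotheses of `chirality_of_cost_five`,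
`q(ω) = +5` when `ω` returns to the `S` side of `r` and `q(ω) = −5` when it returns to the `N` side.
[cite: GlazmanManolescu2019, §2.1 (the winding); Lemma 2.1 (statement, «in the form given in [Gl]»)] [cite: Glazman2015WeightedSAW, Lemma 3.1 (proof, pp. 6–7)] -/
theorem quarterTurns_of_cost_five (hh : holeFaceW w ∉ D) (hr : RootedFace D (w.side .W) r) (h : ω.IsB2a)
    (hA : ω.AJ hr h (toC (midPt (w.side .W))) ≠ 0) (hc : cost (slotOfSide ω.1) ω.2.mids = 5)
    (hinj : ∀ i j, i < ω.2.arcs.length → j < ω.2.arcs.length → ω.2.fc i = ω.2.fc j → i = j)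
    (hstr : ∀ i < ω.2.firstHitG, arcKind (ω.2.sIn i) (ω.2.sOut i) = .straight) :
    (ω.1 = .S ∧ quarterTurnsL ω.2.mids = 5) ∨ (ω.1 = .N ∧ quarterTurnsL ω.2.mids = -5) := by
  obtain ⟨-, hW⟩ := root_row_of_straight_prefix hh hr h hstr
  obtain ⟨h01, h02, h12⟩ := ω.firstSide_exit_return_distinct hr h
  have hq := quarterTurnsL_of_straight_prefix hr h hstr
  have hsum := excursion_quarterTurns_of_wound hr h hA
  rw [hW] at h01 h02 hq hsum
  rw [hsum] at hq
  generalize hz1 : ω.z1 hr h = z₁ at h01 h12 hq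
  rcases end_slanted_of_injective_cost_five hh hr h hA hc hinj with e | e
  · have hwt : woundTurns Side.W z₁ ω.1 = woundTurns Side.W z₁ Side.N := by rw [e]
    have h12' : z₁ ≠ Side.N := fun h' => h12 (h'.trans e.symm)
    rw [hwt] at hq
    refine Or.inr ⟨e, ?_⟩
    revert h01 h12' hq
    cases z₁ <;> simp [woundTurns, qTurn]
  · have hwt : woundTurns Side.W z₁ ω.1 = woundTurns Side.W z₁ Side.S := by rw [e]
    have h12' : z₁ ≠ Side.S := fun h' => h12 (h'.trans e.symm)
    rw [hwt] at hq
    refine Or.inl ⟨e, ?_⟩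
    revert h01 h12' hq
    cases z₁ <;> simp [woundTurns, qTurn]

/-! ## Chirality at limit cost `7` with a vertical end (the parents of the level-`5` class-`B2b` members) -/

/-- ★★★ **CHIRALITY AT LIMIT COST `7`, END SIDE `E`.** A wound class-`B2a` walk from the hole root of limit cost `7` returning to the `E`
side of `r`, with straight prefix and injective plaquette map, has six turning arcs, all of ONE chirality: it leaves `r` through `N`
and every turning arc is a LEFT quarter turn, or it leaves through `S` and every turning arc is a RIGHT quarter turn. (These are the
parents of the level-`5` class-`B2b` members by `PlaquetteWalkHoleRootExtensionCost.cost_ext₃_eq_five_iff`; census kit j280313: classes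
(E,3,3,0,0,∓6).) [cite: GlazmanManolescu2019, §1, Fig. 1 and eq. (1); Lemma 2.1 (statement, «in the form given in [Gl]»)]
[cite: Glazman2015WeightedSAW, Lemma 3.1 (proof, pp. 6–7)] -/
theorem chirality_of_cost_seven_east (hh : holeFaceW w ∉ D) (hr : RootedFace D (w.side .W) r) (h : ω.IsB2a)
    (hA : ω.AJ hr h (toC (midPt (w.side .W))) ≠ 0) (hE : ω.1 = .E) (hc : cost (slotOfSide ω.1) ω.2.mids = 7)
    (hinj : ∀ i j, i < ω.2.arcs.length → j < ω.2.arcs.length → ω.2.fc i = ω.2.fc j → i = j)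
    (hstr : ∀ i < ω.2.firstHitG, arcKind (ω.2.sIn i) (ω.2.sOut i) = .straight) :
    (ω.z1 hr h = .N ∧ ∀ p ∈ ω.2.arcs, qTurnOf p ≠ 0 → qTurnOf p = 1) ∨
      (ω.z1 hr h = .S ∧ ∀ p ∈ ω.2.arcs, qTurnOf p ≠ 0 → qTurnOf p = -1) := by
  have hfh := ω.fh_lt h
  obtain ⟨-, hW⟩ := root_row_of_straight_prefix hh hr h hstr
  -- six turning arcs in all
  have hd : slotDeg (slotOfSide ω.1) = 0 := by rw [hE]; rfl
  have hiso : cfgCount ω.2.mids [.corner] + cfgCount ω.2.mids [.coCorner] = 6 := by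
    unfold cost at hc; rw [hd] at hc; omega
  obtain ⟨hp1, hp2⟩ := ω.2.pairs_eq_zero_of_injective hinj
  have hT : ω.2.arcs.countP (fun p => qTurnOf p ≠ 0) = 6 := by
    rw [ω.2.turns_eq_isolated_add_two_pairs, hp1, hp2, hiso]
  have hsplit := excursion_turns_of_straight_prefix hr h hstr
  rw [hT, hW] at hsplit
  obtain ⟨h01, h02, h12⟩ := ω.firstSide_exit_return_distinct hr h
  rw [hW] at h01 h02
  have htight := excursion_chirality_of_tight hr h hA
  rw [hW] at htight
  have hwt : woundTurns Side.W (ω.z1 hr h) ω.1 = woundTurns Side.W (ω.z1 hr h) Side.E := by rw [hE]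
  have h12' : ω.z1 hr h ≠ Side.E := fun h' => h12 (h'.trans hE.symm)
  rw [hwt] at htight
  have hpre : ∀ p ∈ ω.2.arcs, qTurnOf p ≠ 0 → p ∉ ω.2.arcs.drop (ω.2.firstHitG + 1) →
      qTurnOf p = qTurn Side.W (ω.z1 hr h) := by
    intro p hp hq hnd
    rw [arcs_eq_take_append h, List.mem_append, List.mem_cons] at hp
    rcases hp with hp | rfl | hp
    · exact absurd (ω.2.qTurnOf_eq_zero_of_mem_take hfh.le hstr hp) hq
    · obtain ⟨-, hf2, hf3⟩ := fc_fh ω hr h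
      rw [ω.2.qTurnOf_getElem hfh, hf2, hf3, hW]; rfl
    · exact absurd hp hnd
  have finish : ∀ ε : ℤ, (∀ p ∈ ω.2.arcs.drop (ω.2.firstHitG + 1), qTurnOf p ≠ 0 → qTurnOf p = ε) →
      qTurn Side.W (ω.z1 hr h) = ε → ∀ p ∈ ω.2.arcs, qTurnOf p ≠ 0 → qTurnOf p = ε := by
    intro ε hall hfirst p hp hq
    by_cases hmem : p ∈ ω.2.arcs.drop (ω.2.firstHitG + 1)
    · exact hall p hmem hq
    · exact (hpre p hp hq hmem).trans hfirst
  generalize hz1 : ω.z1 hr h = z₁ at h01 h12' hsplit htight hpre finish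
  cases z₁
  · exact absurd rfl h01
  · exact absurd rfl h12'
  · -- exit `S` (first arc `W → S`, a right turn): five turning arcs in the excursion, `woundTurns W S E = −5`
    have hq1 : qTurn Side.W Side.S = -1 := rfl
    have hcnt : (ω.2.arcs.drop (ω.2.firstHitG + 1)).countP (fun p => qTurnOf p ≠ 0) = 5 := by
      have : (ω.2.arcs.drop (ω.2.firstHitG + 1)).countP (fun p => qTurnOf p ≠ 0) + 1 = 6 := by simpa [hq1] using hsplit
      omega
    have hv : woundTurns Side.W Side.S Side.E = -5 := rfl
    rw [hv] at htight
    rcases htight (by rw [hcnt]; rfl) with ⟨habs, -⟩ | ⟨-, hall⟩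
    · exact absurd habs (by norm_num)
    · exact Or.inr ⟨rfl, finish (-1) hall hq1⟩
  · -- exit `N` (first arc `W → N`, a left turn): five turning arcs in the excursion, `woundTurns W N E = +5`
    have hq1 : qTurn Side.W Side.N = 1 := rfl
    have hcnt : (ω.2.arcs.drop (ω.2.firstHitG + 1)).countP (fun p => qTurnOf p ≠ 0) = 5 := by
      have : (ω.2.arcs.drop (ω.2.firstHitG + 1)).countP (fun p => qTurnOf p ≠ 0) + 1 = 6 := by simpa [hq1] using hsplit
      omega
    have hv : woundTurns Side.W Side.N Side.E = 5 := rfl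
    rw [hv] at htight
    rcases htight (by rw [hcnt]; rfl) with ⟨-, hall⟩ | ⟨habs, -⟩
    · exact Or.inl ⟨rfl, finish 1 hall hq1⟩
    · exact absurd habs (by norm_num)

/-- ★★ **THE SIGNED QUARTER TURNS OF A COST-`7` PARENT ARE `±6`**: under the hypotheses of `chirality_of_cost_seven_east`, `q(ω) = +6`
when `ω` leaves `r` through `N` and `q(ω) = −6` when it leaves through `S`. [cite: GlazmanManolescu2019, §2.1 (the winding); Lemma 2.1]
[cite: Glazman2015WeightedSAW, Lemma 3.1 (proof, pp. 6–7)] -/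
theorem quarterTurns_of_cost_seven_east (hh : holeFaceW w ∉ D) (hr : RootedFace D (w.side .W) r) (h : ω.IsB2a)
    (hA : ω.AJ hr h (toC (midPt (w.side .W))) ≠ 0) (hE : ω.1 = .E)
    (hstr : ∀ i < ω.2.firstHitG, arcKind (ω.2.sIn i) (ω.2.sOut i) = .straight) :
    (ω.z1 hr h = .N ∧ quarterTurnsL ω.2.mids = 6) ∨ (ω.z1 hr h = .S ∧ quarterTurnsL ω.2.mids = -6) := by
  obtain ⟨-, hW⟩ := root_row_of_straight_prefix hh hr h hstr
  obtain ⟨h01, h02, h12⟩ := ω.firstSide_exit_return_distinct hr h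
  have hq := quarterTurnsL_of_straight_prefix hr h hstr
  have hsum := excursion_quarterTurns_of_wound hr h hA
  rw [hW] at h01 h02 hq hsum
  rw [hsum] at hq
  have hwt : woundTurns Side.W (ω.z1 hr h) ω.1 = woundTurns Side.W (ω.z1 hr h) Side.E := by rw [hE]
  have h12' : ω.z1 hr h ≠ Side.E := fun h' => h12 (h'.trans hE.symm)
  rw [hwt] at hq
  generalize hz1 : ω.z1 hr h = z₁ at h01 h12' hq
  revert h01 h12' hq
  cases z₁ <;> simp [woundTurns, qTurn]

end ΩG

end Literature.Probability.RandomPlanarGeometry.SAW.YangBaxter
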